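import Mathlib.Analysis.SpecialFunctions.Log.Basic
import Literature.NumberTheory.ConnesConsani2023.RiemannRochSpecZTheorem
import Literature.NumberTheory.ConnesConsani2023.RiemannRochRingZDimH1
import Literature.NumberTheory.ConnesConsani2023.RiemannRochRingZDimH0
import HarnessLib

/-!
# Connes–Consani, Riemann–Roch for the ring `ℤ` (2024) — PROOF of the Riemann–Roch formula (Theorem 5.1)

Discharges the named fact `Literature.NumberTheory.ConnesConsani2023.RiemannRoch_ringZ`
(A. Connes, C. Consani, *Riemann–Roch for the ring `ℤ`*, C. R. Math. 362 (2024) 229–235 = arXiv:2306.00456,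
Thm. 5.1 p. 6 [bib: `ConnesConsani2024RiemannRochZ`]): for every Arakelov divisor `D` on `\overline{Spec ℤ}`,
`dim_𝕊 H⁰(D) − dim_𝕊 H¹(D) = ⌈deg₂ D⌉' + 1` (`⌈·⌉'` = `rcCeil`, `deg₂ = deg / log 2`).

We FOLLOW THE PRINTED PROOF (p. 6): the reductions `dim_𝕊 H⁰(D) = dim_𝕊 (Hℤ)_{[-n,n]}`, `n = ⌊e^{deg D}⌋`
(`sDimH0_eq`: rescaling of the lattice `L = gen D · ℤ` by `gen D`, `e^a/gen D = e^{deg D}` from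
`RiemannRochSpecZTheorem.lean`, and integrality `sGenerates_int_iff`) and `dim_𝕊 H¹(D) = dim_𝕊 U(1)_{e^{deg D}}`
(`sDimH1_eq`: the rescaling `ℝ/(gen D)ℤ ≃ ℝ/ℤ` multiplies distances by `1/gen D`); then
* `deg D ≥ 0`: Thm. 3.3 (`sDim_HZ_eq` of `RiemannRochRingZDimH0.lean`, with `log₂ ⌊λ⌋ = ⌊log₂ λ⌋`) and
  `H¹ = 0` (`sTolDim_eq_zero`), giving `(⌊deg₂ D⌋ + 2) − 0 = ⌈deg₂ D⌉' + 1`;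
* `−log 2 ≤ deg D < 0`: both dimensions vanish and `⌈deg₂ D⌉' + 1 = ⌊deg₂ D⌋ + 1 = 0`;
* `deg D < −log 2`: `H⁰ = 0` and Prop. 4.2 (`sTolDim_U1_eq` of `RiemannRochRingZDimH1.lean`) with
  `m = −⌊deg₂ D⌋ − 1`, giving `−m = ⌊deg₂ D⌋ + 1`.

Cell `pub-rhdoor`, seat cc-2.  With this file both Riemann–Roch theorems of Connes–Consani for the CURVE
`\overline{Spec ℤ}` (2023, over `𝕊[±1]`; 2024, over `𝕊`) are machine-checked Literature theorems (axioms
`propext`, `Classical.choice`, `Quot.sound`); they concern integer-valued dimensions and have no bearing on RH.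
-/

noncomputable section

open Set Finset

namespace Literature.NumberTheory.ConnesConsani2023

/-! ## Reductions -/

/-- `𝕊`-generation of `(HL)_λ` is invariant under rescaling `x ↦ c x` (`c > 0`) of lattice, bound and
generating set. [folklore] -/
theorem sGenerates_smul {E : Set ℝ} {lam c : ℝ} (hc : 0 < c) {G : Finset ℝ}
    (h : SGenerates E lam G) :
    SGenerates ((fun x => c * x) '' E) (c * lam) (G.image fun x => c * x) := by
  classical
  obtain ⟨hGE, hgen⟩ := h
  have hinj : Function.Injective fun x : ℝ => c * x := fun a b hab => mul_left_cancel₀ hc.ne' hab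
  refine ⟨?_, ?_⟩
  · intro y hy
    obtain ⟨x, hx, rfl⟩ := Finset.mem_image.mp (Finset.mem_coe.mp hy)
    exact ⟨x, hGE (Finset.mem_coe.mpr hx), rfl⟩
  · rintro y ⟨x, hx, rfl⟩
    obtain ⟨Z, hZ, hsum, hadm⟩ := hgen x hx
    refine ⟨Z.image fun x => c * x, Finset.image_subset_image hZ, ?_, ?_⟩
    · rw [Finset.sum_image fun a _ b _ hab => hinj hab, ← Finset.mul_sum, hsum]
    · intro Z' hZ'
      obtain ⟨W, hW, rfl⟩ := Finset.subset_image_iff.mp hZ'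
      rw [Finset.sum_image fun a _ b _ hab => hinj hab, ← Finset.mul_sum, abs_mul, abs_of_pos hc]
      exact mul_le_mul_of_nonneg_left (hadm W hW) hc.le

/-- `dim_𝕊` is invariant under rescaling. [folklore] -/
theorem sDim_smul {E : Set ℝ} {lam c : ℝ} (hc : 0 < c) :
    sDim ((fun x => c * x) '' E) (c * lam) = sDim E lam := by
  classical
  unfold sDim
  congr 1
  ext k
  constructor
  · rintro ⟨G, hG, hgen⟩
    have h := sGenerates_smul (inv_pos.mpr hc) hgen
    have hE : (fun x => c⁻¹ * x) '' ((fun x => c * x) '' E) = E := by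
      rw [Set.image_image]; simp [inv_mul_cancel_left₀ hc.ne']
    rw [hE, inv_mul_cancel_left₀ hc.ne'] at h
    refine ⟨_, ?_, h⟩
    rw [Finset.card_image_of_injective _ fun a b hab => mul_left_cancel₀ (inv_ne_zero hc.ne') hab]
    exact hG
  · rintro ⟨G, hG, hgen⟩
    refine ⟨_, ?_, sGenerates_smul hc hgen⟩
    rw [Finset.card_image_of_injective _ fun a b hab => mul_left_cancel₀ hc.ne' hab]
    exact hG

/-- `{m ∈ ℤ : |m| ≤ λ} = {m ∈ ℤ : |m| ≤ ⌊λ⌋}` for `λ ≥ 0`. [folklore] -/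
theorem intBall_eq_HZball {lam : ℝ} (hlam : 0 ≤ lam) :
    {y : ℝ | (∃ m : ℤ, y = m) ∧ |y| ≤ lam} = HZball ⌊lam⌋₊ := by
  have hn : (⌊lam⌋₊ : ℝ) ≤ lam := Nat.floor_le hlam
  have h2 : ((⌊lam⌋ : ℤ) : ℝ) = (⌊lam⌋₊ : ℝ) := by
    rw [← Int.natCast_floor_eq_floor hlam]; simp
  ext y
  simp only [HZball, Set.mem_setOf_eq]
  constructor
  · rintro ⟨⟨m, rfl⟩, hm⟩
    refine ⟨⟨m, rfl⟩, ?_⟩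
    have h1 : (|m| : ℤ) ≤ ⌊lam⌋ := Int.le_floor.mpr (by push_cast; exact hm)
    rw [← Int.cast_abs, ← h2]
    exact_mod_cast h1
  · rintro ⟨⟨m, rfl⟩, hm⟩
    exact ⟨⟨m, rfl⟩, hm.trans hn⟩

/-- Integrality: on integer points the real bound `λ ≥ 0` may be replaced by `⌊λ⌋₊`, both for the level
set and for the (integer) partial sums: `(Hℤ)_{[-λ,λ]} = (Hℤ)_{[-⌊λ⌋,⌊λ⌋]}` as far as `𝕊`-generation goes. [folklore] -/
theorem sGenerates_int_iff {lam : ℝ} (hlam : 0 ≤ lam) (G : Finset ℝ) :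
    SGenerates {y : ℝ | (∃ m : ℤ, y = m) ∧ |y| ≤ lam} lam G ↔
      SGenerates (HZball ⌊lam⌋₊) (⌊lam⌋₊ : ℝ) G := by
  have hn : (⌊lam⌋₊ : ℝ) ≤ lam := Nat.floor_le hlam
  have h2 : ((⌊lam⌋ : ℤ) : ℝ) = (⌊lam⌋₊ : ℝ) := by
    rw [← Int.natCast_floor_eq_floor hlam]; simp
  rw [intBall_eq_HZball hlam]
  -- partial sums of subsets of `G ⊆ ℤ` are integers
  have key : ∀ {Z' : Finset ℝ}, (↑G ⊆ HZball ⌊lam⌋₊) → Z' ⊆ G →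
      (|∑ i ∈ Z', i| ≤ lam ↔ |∑ i ∈ Z', i| ≤ (⌊lam⌋₊ : ℝ)) := by
    intro Z' hG hZ'
    have hint : ∀ j ∈ Z', (j : ℝ) = ((⌊j⌋ : ℤ) : ℝ) := by
      intro j hj
      obtain ⟨⟨m, hm⟩, -⟩ := hG (Finset.mem_coe.mpr (hZ' hj))
      rw [hm, Int.floor_intCast]
    rw [Finset.sum_congr rfl hint, ← Int.cast_sum, ← Int.cast_abs]
    constructor
    · intro h
      have h1 : |∑ i ∈ Z', ⌊i⌋| ≤ ⌊lam⌋ := Int.le_floor.mpr h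
      rw [← h2]; exact_mod_cast h1
    · intro h; exact h.trans hn
  constructor
  · rintro ⟨hG, hgen⟩
    refine ⟨hG, fun x hx => ?_⟩
    obtain ⟨Z, hZ, hsum, hadm⟩ := hgen x hx
    exact ⟨Z, hZ, hsum, fun Z' hZ' => (key hG (hZ'.trans hZ)).mp (hadm Z' hZ')⟩
  · rintro ⟨hG, hgen⟩
    refine ⟨hG, fun x hx => ?_⟩
    obtain ⟨Z, hZ, hsum, hadm⟩ := hgen x hx
    exact ⟨Z, hZ, hsum, fun Z' hZ' => (key hG (hZ'.trans hZ)).mpr (hadm Z' hZ')⟩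

/-- `dim_𝕊 H⁰(D) = dim_𝕊 (Hℤ)_{[-n,n]}` with `n = ⌊e^{deg D}⌋` (proof of Thm. 3.3: "`H⁰(D)` is the `𝕊`-module
`(Hℤ)_I` where … `n` is the integer part of `e^{deg D}`"; realised by rescaling the lattice by `gen D`). [cite: ConnesConsani2024RiemannRochZ, Thm. 3.3 p. 4] -/
theorem sDimH0_eq (D : ArakelovDivisor) :
    sDimH0 D = sDim (HZball ⌊Real.exp D.deg⌋₊) ⌊Real.exp D.deg⌋₊ := by
  have hgen : 0 < D.gen := D.gen_pos
  unfold sDimH0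
  rw [← sDim_smul (inv_pos.mpr hgen) (E := D.H0set) (lam := Real.exp D.inf), D.smul_H0set,
    show D.gen⁻¹ * Real.exp D.inf = Real.exp D.deg by rw [D.exp_deg]; ring]
  unfold sDim
  congr 1
  ext k
  simp only [Set.mem_setOf_eq, sGenerates_int_iff (Real.exp_pos _).le]

/-- Tolerant `𝕊`-generation is transported by the rescaling `ℝ/pℤ ≃+ ℝ/qℤ` (bound scaled by `q/p`).
[folklore] -/
theorem sTolGenerates_equiv {p q : ℝ} (hp : 0 < p) (hq : 0 < q) {lam : ℝ}
    {F : Finset (AddCircle p)} (h : STolGenerates lam F) :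
    STolGenerates (q / p * lam) (F.image (AddCircle.equivAddCircle p q hp.ne' hq.ne')) := by
  classical
  set φ := AddCircle.equivAddCircle p q hp.ne' hq.ne' with hφ
  obtain ⟨hsep, hcov⟩ := h
  have hqp : 0 < q / p := div_pos hq hp
  refine ⟨?_, ?_⟩
  · intro x hx y hy hxy
    obtain ⟨a, ha, rfl⟩ := Finset.mem_image.mp hx
    obtain ⟨b, hb, rfl⟩ := Finset.mem_image.mp hy
    have hab : a ≠ b := fun h => hxy (by rw [h])
    rw [dist_equivAddCircle hp hq]
    exact mul_lt_mul_of_pos_left (hsep a ha b hb hab) hqp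
  · intro z
    obtain ⟨x, rfl⟩ := φ.surjective z
    obtain ⟨Z, hZ, hdist⟩ := hcov x
    refine ⟨Z.image φ, Finset.image_subset_image hZ, ?_⟩
    rw [Finset.sum_image fun a _ b _ hab => φ.injective hab, ← map_sum, dist_equivAddCircle hp hq]
    exact mul_le_mul_of_nonneg_left hdist hqp.le

/-- `dim_𝕊 (ℝ/qℤ, d)_{(q/p)λ} = dim_𝕊 (ℝ/pℤ, d)_λ`. [folklore] -/
theorem sTolDim_equiv {p q : ℝ} (hp : 0 < p) (hq : 0 < q) (lam : ℝ) :
    sTolDim (AddCircle q) (q / p * lam) = sTolDim (AddCircle p) lam := by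
  classical
  unfold sTolDim
  congr 1
  ext k
  constructor
  · rintro ⟨G, hG, hgen⟩
    have h := sTolGenerates_equiv hq hp hgen
    rw [show p / q * (q / p * lam) = lam by field_simp] at h
    refine ⟨_, ?_, h⟩
    rw [Finset.card_image_of_injective _ (AddCircle.equivAddCircle q p hq.ne' hp.ne').injective]
    exact hG
  · rintro ⟨G, hG, hgen⟩
    refine ⟨_, ?_, sTolGenerates_equiv hp hq hgen⟩
    rw [Finset.card_image_of_injective _ (AddCircle.equivAddCircle p q hp.ne' hq.ne').injective]
    exact hG

/-- `dim_𝕊 H¹(D) = dim_𝕊 U(1)_λ`, `λ = e^{deg D}` (§4 p. 5, via 2023 App. A–B: `H¹(D) = (ℝ/L, d)_{e^a}` rescaled).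
[cite: ConnesConsani2024RiemannRochZ, Prop. 4.2 p. 5] -/
theorem sDimH1_eq (D : ArakelovDivisor) : sDimH1 D = sTolDim (AddCircle (1 : ℝ)) (Real.exp D.deg) := by
  have hgen : 0 < D.gen := D.gen_pos
  unfold sDimH1
  rw [← sTolDim_equiv hgen one_pos (Real.exp D.inf), D.exp_deg]
  congr 1
  ring

/-- **Theorem 5.1 (= Thm. 1.1) of Connes–Consani 2024 — Riemann–Roch for the ring `ℤ` — PROVED**
(discharges the named fact `RiemannRoch_ringZ`): for every Arakelov divisor `D` on `\overline{Spec ℤ}`,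
`dim_𝕊 H⁰(D) − dim_𝕊 H¹(D) = ⌈deg₂ D⌉' + 1`.  Proof as printed (p. 6): `deg D ≥ 0` from Thm. 3.3
(`sDim_HZ_eq`, `⌊log₂ λ⌋ = log₂ ⌊λ⌋`) and `H¹ = 0`; `deg D < 0` from `H⁰ = 0` and Prop. 4.2 (`sTolDim_U1_eq` with
`m = -⌊deg₂ D⌋ - 1`, or `0` when `λ ≥ 1/2`). [cite: ConnesConsani2024RiemannRochZ, Thm. 5.1 p. 6] -/
theorem RiemannRoch_ringZ_holds : RiemannRoch_ringZ := by
  intro D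
  have hlog2 : 0 < Real.log 2 := Real.log_pos (by norm_num)
  set a := D.deg with ha
  set lam := Real.exp a with hlam
  have hlam0 : 0 < lam := Real.exp_pos a
  have hloglam : Real.log lam = a := Real.log_exp a
  rw [sDimH0_eq, sDimH1_eq]
  set n := ⌊lam⌋₊ with hn
  have hnle : (n : ℝ) ≤ lam := Nat.floor_le hlam0.le
  have hnlt : lam < n + 1 := Nat.lt_floor_add_one lam
  by_cases hcase : 1 ≤ lam
  · -- `deg D ≥ 0`
    have hn1 : 1 ≤ n := by rw [hn]; exact Nat.le_floor (by exact_mod_cast hcase)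
    rw [sDim_HZ_eq hn1, sTolDim_eq_zero (by linarith)]
    have ht0 : 0 ≤ a / Real.log 2 := by
      apply div_nonneg _ hlog2.le
      rw [← hloglam]; exact Real.log_nonneg hcase
    rw [rcCeil, if_pos ht0]
    -- `⌊log₂ λ⌋ = log₂ n`
    set k := Nat.log 2 n with hk
    have h1 : 2 ^ k ≤ n := Nat.pow_log_le_self 2 (by omega)
    have h2 : n < 2 ^ (k + 1) := Nat.lt_pow_succ_log_self (by norm_num) n
    have hfloor : ⌊a / Real.log 2⌋ = (k : ℤ) := by
      rw [Int.floor_eq_iff]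
      push_cast
      constructor
      · rw [le_div_iff₀ hlog2, ← hloglam]
        have h1R : (2 : ℝ) ^ k ≤ lam := le_trans (by exact_mod_cast h1) hnle
        have := Real.log_le_log (by positivity) h1R
        rwa [Real.log_pow] at this
      · rw [div_lt_iff₀ hlog2, ← hloglam]
        have h2R : lam < (2 : ℝ) ^ (k + 1) := by
          have : (n : ℝ) + 1 ≤ (2 : ℝ) ^ (k + 1) := by exact_mod_cast h2
          linarith
        have := Real.log_lt_log hlam0 h2R
        rw [Real.log_pow] at this; push_cast at this; linarith
    rw [hfloor]; push_cast; ring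
  · -- `deg D < 0`
    have hlt : lam < 1 := lt_of_not_ge hcase
    have hn0 : n = 0 := by
      rw [hn, Nat.floor_eq_zero]; exact hlt
    rw [hn0, Nat.cast_zero, sDim_HZ_zero]
    have ht : a / Real.log 2 < 0 := by
      apply div_neg_of_neg_of_pos _ hlog2
      rw [← hloglam]; exact Real.log_neg hlam0 hlt
    rw [rcCeil, if_neg (not_le.mpr ht)]
    by_cases hhalf : 1 / 2 ≤ lam
    · rw [sTolDim_eq_zero hhalf]
      have hfloor : ⌊a / Real.log 2⌋ = -1 := by
        rw [Int.floor_eq_iff]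
        push_cast
        constructor
        · rw [le_div_iff₀ hlog2, ← hloglam]
          have := Real.log_le_log (by norm_num) hhalf
          rw [one_div, Real.log_inv] at this
          linarith
        · rw [div_lt_iff₀ hlog2, ← hloglam]
          have := Real.log_neg hlam0 hlt
          linarith
      rw [hfloor]; norm_num
    · have hlt2 : lam < 1 / 2 := lt_of_not_ge hhalf
      -- `m = -⌊log₂ λ⌋ - 1 ≥ 1` with `2^{-m-1} ≤ λ < 2^{-m}`
      set f := ⌊a / Real.log 2⌋ with hf
      have hf2 : f ≤ -2 := by
        have : a / Real.log 2 < -1 := by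
          rw [div_lt_iff₀ hlog2, ← hloglam]
          have := Real.log_lt_log hlam0 hlt2
          rw [one_div, Real.log_inv] at this
          linarith
        have := Int.floor_le (a / Real.log 2)
        have h' : (f : ℝ) < -1 := lt_of_le_of_lt this (by linarith)
        have : f < -1 := by exact_mod_cast h'
        omega
      obtain ⟨m, hm⟩ : ∃ m : ℕ, (m : ℤ) = -f - 1 := ⟨(-f - 1).toNat, Int.toNat_of_nonneg (by omega)⟩
      have hfm : f = -(m : ℤ) - 1 := by omega
      have hfl := (Int.floor_eq_iff).mp
        (show ⌊a / Real.log 2⌋ = -(m : ℤ) - 1 by rw [← hf]; exact hfm)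
      have hlo : 1 / (2 : ℝ) ^ (m + 1) ≤ lam := by
        have h := hfl.1
        push_cast at h
        rw [le_div_iff₀ hlog2, ← hloglam] at h
        have : Real.log (1 / (2 : ℝ) ^ (m + 1)) ≤ Real.log lam := by
          rw [one_div, Real.log_inv, Real.log_pow]; push_cast; linarith
        exact (Real.log_le_log_iff (by positivity) hlam0).mp this
      have hhi : lam < 1 / (2 : ℝ) ^ m := by
        have h := hfl.2
        push_cast at h
        rw [div_lt_iff₀ hlog2, ← hloglam] at h
        have : Real.log lam < Real.log (1 / (2 : ℝ) ^ m) := by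
          rw [one_div, Real.log_inv, Real.log_pow]; linarith
        exact (Real.log_lt_log_iff hlam0 (by positivity)).mp this
      rw [sTolDim_U1_eq m hlo hhi, hfm]
      push_cast; ring


end Literature.NumberTheory.ConnesConsani2023

end
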